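import Literature.AlgebraicGeometry.Motives.GrassmannianPluckerData
import HarnessLib

/-!
# The Plücker morphism `Gr(k, M) → 𝐏ʳ_ℤ` from the determinant of the universal quotient, and the class identity
# `[𝒪_{Gr}(-1)] = [det 𝒬]⁻¹`

Topic `AlgebraicGeometry/Motives`; namespace `Literature.AlgebraicGeometry.Motives.Grassmannian`.  Cell `hodgecm-mathlib`
(D-0151), F-13 «Plücker class of the linearly rigidified covariant», row **P2a** of the census-first memo
`B-provers/B-p10/g13/CENSUS-F13-PluckerPL.B-p10g13.md` — the PROOF half of the P2a pair (no definitions; the data `chartAt`,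
`detFrameSystem`, `pluckerSection`, `pluckerDatum` live in ★ `Motives/GrassmannianPluckerData`).  Count-neutral Mathlib-side capital:
HC_CM is proved only modulo the 7 printed citations until rung 0 closes — nothing here bears on a summit statement.

For a finite free abelian group `M` with basis `b : J → M` and `Gr = grassmannianScheme M k` with universal rank-`k` quotient
`𝒬 = universalQuotient k M b`, the PLÜCKER MORPHISM `θ : Gr → 𝐏ʳ_ℤ` ([GortzWedhorn2020] (8.10); [EisenbudHarris2016] §3.2.2) is the morphism of
[Hartshorne1977] II Thm. 7.1 (★ `GeneratingSections.toProj`) of the Plücker datum: line bundle `det 𝒬` (as the cocycle line bundle of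
`det g_{II'}`), sections the maximal minors `p_I`.

* §1 the non-vanishing locus of a maximal minor is the overlap of two charts (`D(det t_{ad}) = U_a ∩ U_d`, ★ `mem_chart_iff_isUnit_det_transition`),
  hence the opens of the Plücker datum ARE the standard charts `Gr_{p_{e i}} = U_{e i}` and its ratios are the maximal minors.
* §2 ring side: every chart variable `X_{(j,i)}` is a maximal minor (`Matrix.cramer_one`), so the minors generate the chart ring; §3 chart
  transport of the minors along `ℤ[X_I] ≅ Γ(Gr, U_I)`; §4 the empty case `#J < k`; §5 the head `exists_isClosedImmersion_PP_detClass_serreTwist` (NO hypothesis on `k`): **a closed immersion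
  `θ : Gr ⟶ 𝐏ʳ_ℤ` with `detClass (serreTwist θ 1) = (detClass 𝒬)⁻¹`** (★ `isClosedImmersion_toProj`, ★ `detClass_serreTwist_toProj`).

## References
* [GortzWedhorn2020] U. Görtz, T. Wedhorn, *Algebraic Geometry I*, 2nd ed. (2020), (8.10), Prop. 8.23 (p. 220); (8.4) (pp. 213–215).
* [EisenbudHarris2016] D. Eisenbud, J. Harris, *3264 and All That* (2016), §3.2.2.
* [Hartshorne1977] R. Hartshorne, *Algebraic Geometry* (1977), II Thm. 7.1, Prop. 7.2 (pp. 150–151); II proof of Thm. 7.1.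
* [StacksProject] The Stacks project, Tag 089T.
-/

noncomputable section
-- `TopCat.Presheaf`/`Scheme.Modules` are not reducible (as in Mathlib's `AlgebraicGeometry/Modules/Sheaf.lean`).
set_option backward.isDefEq.respectTransparency false

namespace Literature.AlgebraicGeometry.Motives.Grassmannian

open CategoryTheory Opposite TopologicalSpace _root_.AlgebraicGeometry
open Literature.AlgebraicGeometry.Modules Literature.AlgebraicGeometry.Motives.GeneratingSections

universe u

variable (k : ℕ) (M : Type u) [AddCommGroup M] {J : Type u} (b : Module.Basis J ℤ M)
  [(grassmannianSheaf M k).obj.IsRepresentable]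

/-! ## §1 The non-vanishing locus of a maximal minor is the overlap of two charts; the opens and ratios of the Plücker datum -/

/-- On an affine `W ≤ U_a`: `W ≤ U_d ↔ det t_{ad}|_W` is a unit — «`U_a ∩ U_d = D(det g_{ad}) ⊆ U_a`», ★ `mem_chart_iff_isUnit_det_transition`
read on the universal point through ★ `le_chartLocus_iff_evalAffine_mem_chart` and ★ `opensRange_chartι_eq`.
[cite: GortzWedhorn2020, (8.4) (pp. 213–215)] [cite: StacksProject, Tag 089T] -/
theorem le_U_iff_isUnit_det_transitionAt (a d : {I : Fin k → J // Function.Injective I})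
    {W : (grassmannianScheme M k).Opens} (hW : IsAffineOpen W) (ha : W ≤ (universalChartData k M b).U a) :
    W ≤ (universalChartData k M b).U d ↔ IsUnit ((universalChartData k M b).transitionAt a d hW ha).det := by
  rw [universalChartData_U, opensRange_chartι_eq, le_chartLocus_iff_evalAffine_mem_chart _ _ hW,
    mem_chart_iff_isUnit_det_transition (⇑b ∘ (universalChartData k M b).frame a) (⇑b ∘ d.1) _
      ((universalChartData k M b).evalAffine_mem_chart hW ha)]
  rfl

/-- **`D(det t_{ad}) = U_a ∩ U_d`**: the non-vanishing locus of the maximal minor of the frame `d`, computed on the chart `U_a`, is the overlap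
`U_a ∩ U_d` ([EisenbudHarris2016] §3.2.2: the Plücker coordinate `p_d` vanishes exactly off the chart `U_d`).
[cite: EisenbudHarris2016, §3.2.2] [cite: GortzWedhorn2020, (8.4) (pp. 213–215)] -/
theorem basicOpen_det_transitionAt (a d : {I : Fin k → J // Function.Injective I}) :
    (grassmannianScheme M k).basicOpen
        ((universalChartData k M b).transitionAt a d ((universalChartData k M b).isAffineOpen a) le_rfl).det =
      (universalChartData k M b).U a ⊓ (universalChartData k M b).U d := by
  set D := universalChartData k M b with hD
  set δ := (D.transitionAt a d (D.isAffineOpen a) le_rfl).det with hδ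
  refine le_antisymm ?_ ?_
  · -- `D(δ)` is affine, inside `U_a`, and `δ` is a unit on it
    have hW : IsAffineOpen ((grassmannianScheme M k).basicOpen δ) := (D.isAffineOpen a).basicOpen δ
    have ha : (grassmannianScheme M k).basicOpen δ ≤ D.U a := (grassmannianScheme M k).basicOpen_le δ
    refine le_inf ha ((le_U_iff_isUnit_det_transitionAt k M b a d hW ha).2 ?_)
    rw [← secRes_det_transitionAt k M b a d (D.isAffineOpen a) hW le_rfl ha]
    exact RingedSpace.isUnit_res_basicOpen _ δ
  · -- on the affine `U_a ∩ U_d` the minor is a unit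
    have hW : IsAffineOpen (D.U a ⊓ D.U d) := D.isAffineOpen_inf a d
    have hu : IsUnit ((D.transitionAt a d hW inf_le_left).det) :=
      (le_U_iff_isUnit_det_transitionAt k M b a d hW inf_le_left).1 inf_le_right
    rw [← secRes_det_transitionAt k M b a d (D.isAffineOpen a) hW le_rfl inf_le_left] at hu
    have h := (grassmannianScheme M k).basicOpen_of_isUnit hu
    rw [Modules.secRes, Scheme.basicOpen_res] at h
    exact inf_eq_left.mp h

/-- **The non-vanishing locus of the coefficient of `p_{e i}` at `x` is `U_{chartAt x} ∩ U_{e i}`.** [cite: EisenbudHarris2016, §3.2.2] -/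
theorem basicOpen_coeffAt_pluckerSection {ι₀ : Type} (e : ι₀ → {I : Fin k → J // Function.Injective I}) (i : ι₀)
    (x : grassmannianScheme M k) :
    (grassmannianScheme M k).basicOpen
        (coeffAt (detFrameSystem k M b).cocycle.lineBundleFrameSystem (detFrameSystem k M b).cocycle.lineBundleFrameSystem_rank
          (fun i => pluckerSection k M b (e i)) i x) =
      (universalChartData k M b).U (chartAt k M b x) ⊓ (universalChartData k M b).U (e i) := by
  rw [coeffAt_pluckerSection, basicOpen_det_transitionAt]

section Datum

variable {n : ℕ} (e : Fin (n + 1) → {I : Fin k → J // Function.Injective I})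

/-- **The opens of the Plücker datum are the standard charts: `Gr_{p_{e i}} = U_{e i}`.** [cite: EisenbudHarris2016, §3.2.2]
[cite: GortzWedhorn2020, (8.10) Prop. 8.23 (p. 220)] -/
theorem pluckerDatum_U (he : Function.Surjective e) (i : Fin (n + 1)) :
    (pluckerDatum k M b e he).U i = (universalChartData k M b).U (e i) := by
  rw [ofCocycleSections_U, CocycleSections.ofFrameSystem_coeff]
  refine le_antisymm (iSup_le fun x => ?_) fun t ht => ?_
  · rw [basicOpen_coeffAt_pluckerSection]
    exact inf_le_right
  · refine Opens.mem_iSup.mpr ⟨t, ?_⟩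
    rw [basicOpen_coeffAt_pluckerSection]
    exact ⟨mem_U_chartAt k M b t, ht⟩

/-- The opens of the Plücker datum are affine. [cite: Hartshorne1977, II Prop. 7.2] -/
theorem isAffineOpen_pluckerDatum_U (he : Function.Surjective e) (i : Fin (n + 1)) :
    IsAffineOpen ((pluckerDatum k M b e he).U i) := by
  rw [pluckerDatum_U]
  exact (universalChartData k M b).isAffineOpen (e i)

/-- The coefficient of `p_{e j}` at `x`, restricted to an affine `W ≤ U_{chartAt x}`, is the maximal minor `det t_{chartAt x, e j}` over `W`.
[cite: EisenbudHarris2016, §3.2.2] -/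
theorem secRes_coeff_pluckerCocycleSections (j : Fin (n + 1)) (x : grassmannianScheme M k)
    {W : (grassmannianScheme M k).Opens} (hW : IsAffineOpen W) (hle : W ≤ (universalChartData k M b).U (chartAt k M b x)) :
    Modules.secRes (grassmannianScheme M k) hle ((pluckerCocycleSections k M b e).coeff j x) =
      ((universalChartData k M b).transitionAt (chartAt k M b x) (e j) hW hle).det := by
  have h := coeffAt_pluckerSection k M b e j x
  change Modules.secRes (grassmannianScheme M k) hle
    (coeffAt (detFrameSystem k M b).cocycle.lineBundleFrameSystem (detFrameSystem k M b).cocycle.lineBundleFrameSystem_rank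
      (fun i => pluckerSection k M b (e i)) j x) = _
  rw [h]
  exact secRes_det_transitionAt k M b _ _ _ hW le_rfl hle

/-- **The ratios of the Plücker datum are the maximal minors**: `p_{e j} / p_{e i} = det t_{e i, e j}` on `Gr_{p_{e i}} = U_{e i}` (★
`ofCocycleSections_ratio_unique`: on each `U_{chartAt x} ∩ U_{e i}` the cocycle `t_{a, e i} t_{e i, e j} = t_{a, e j}`, ★ `transitionAt_mul`).
[cite: Hartshorne1977, II proof of Thm. 7.1] [cite: EisenbudHarris2016, §3.2.2] -/
theorem pluckerDatum_ratio (he : Function.Surjective e) (i j : Fin (n + 1)) :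
    (pluckerDatum k M b e he).ratio i j =
      Modules.secRes (grassmannianScheme M k) (pluckerDatum_U k M b e he i).le
        ((universalChartData k M b).transitionAt (e i) (e j) ((universalChartData k M b).isAffineOpen _) le_rfl).det := by
  set D := universalChartData k M b with hD
  symm
  refine ofCocycleSections_ratio_unique _ _ _ i j _ fun x => ?_
  -- the test open `B = Gr_{coeff i x} = U_{chartAt x} ∩ U_{e i}`
  have hB : IsAffineOpen ((grassmannianScheme M k).basicOpen ((pluckerCocycleSections k M b e).coeff i x)) :=
    (D.isAffineOpen (chartAt k M b x)).basicOpen _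
  have hBa : (grassmannianScheme M k).basicOpen ((pluckerCocycleSections k M b e).coeff i x) ≤ D.U (chartAt k M b x) :=
    (grassmannianScheme M k).basicOpen_le _
  have hBi : (grassmannianScheme M k).basicOpen ((pluckerCocycleSections k M b e).coeff i x) ≤ D.U (e i) :=
    (basicOpen_coeffAt_pluckerSection k M b e i x).le.trans inf_le_right
  change Modules.secRes _ (basicOpen_le_ofCocycleSections_U _ _ _ i x) (Modules.secRes _ _ _) *
      Modules.secRes _ hBa ((pluckerCocycleSections k M b e).coeff i x) =
    Modules.secRes _ hBa ((pluckerCocycleSections k M b e).coeff j x)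
  rw [Modules.secRes_secRes, secRes_det_transitionAt k M b _ _ _ hB le_rfl hBi,
    secRes_coeff_pluckerCocycleSections k M b e i x hB hBa, secRes_coeff_pluckerCocycleSections k M b e j x hB hBa,
    mul_comm, ← Matrix.det_mul, D.transitionAt_mul _ _ _ hB hBa hBi]

end Datum

/-! ## §2 Ring side: every chart variable is a maximal minor, so the minors generate the chart ring -/

section ChartRing

variable {k}

/-- Replacing one entry of an injective frame by an index outside its range keeps it injective. [folklore] -/
private theorem injective_update (I : Fin k → J) (hI : Function.Injective I) (i₀ : Fin k) (j : J) (hj : j ∉ Set.range I) :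
    Function.Injective (Function.update I i₀ j) := by
  intro a a' h
  by_cases ha : a = i₀
  · subst ha
    by_cases ha' : a' = a
    · exact ha'.symm
    · rw [Function.update_self, Function.update_of_ne ha'] at h
      exact absurd ⟨a', h.symm⟩ hj
  · by_cases ha' : a' = i₀
    · subst ha'
      rw [Function.update_self, Function.update_of_ne ha] at h
      exact absurd ⟨a, h⟩ hj
    · rw [Function.update_of_ne ha, Function.update_of_ne ha'] at h
      exact hI h

omit [(grassmannianSheaf M k).obj.IsRepresentable] in
/-- **Every chart variable is a maximal minor**: for the frame `I[i₀ ↦ j]` (`j ∉ range I`) the matrix of `I`-coordinates of `b ∘ I[i₀ ↦ j]` is the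
identity with column `i₀` replaced by `(X_{(j,i)})_i`, whose determinant is the variable `X_{(j,i₀)}` ([EisenbudHarris2016] §3.2.2: on the chart
`U_I` the entries of the normalised matrix are Plücker coordinates). [cite: EisenbudHarris2016, §3.2.2] -/
theorem det_chartCoordMap_update (I : Fin k → J) (hI : Function.Injective I) (i₀ : Fin k) (j : J) (hj : j ∉ Set.range I) :
    (Matrix.of fun i' j' => chartCoordMap k M b I (b (Function.update I i₀ j j')) i').det = chartVar k I (⟨j, hj⟩, i₀) := by
  have hM : (Matrix.of fun i' j' => chartCoordMap k M b I (b (Function.update I i₀ j j')) i') =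
      (1 : Matrix (Fin k) (Fin k) (chartRing k I)).updateCol i₀ fun i' => chartVar k I (⟨j, hj⟩, i') := by
    ext i' j'
    rw [Matrix.of_apply, Matrix.updateCol_apply]
    by_cases h : j' = i₀
    · subst h
      rw [if_pos rfl, Function.update_self, chartCoordMap, coordMapOfColumns_basis b I _ j hj]
    · rw [if_neg h, Function.update_of_ne h, show b (I j') = (⇑b ∘ I) j' from rfl, chartCoordMap_frame k M b I hI j',
        Matrix.one_apply, Pi.single_apply]
  rw [hM, ← Matrix.cramer_apply, Matrix.cramer_one]
  rfl

omit [(grassmannianSheaf M k).obj.IsRepresentable] in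
/-- **The maximal minors generate the chart ring `ℤ[X_{(j,i)}]`** (each variable is one of them). [cite: EisenbudHarris2016, §3.2.2]
[cite: Hartshorne1977, II Prop. 7.2] -/
theorem closure_range_det_chartCoordMap (I : {I : Fin k → J // Function.Injective I}) :
    Subring.closure (Set.range fun d : {I : Fin k → J // Function.Injective I} =>
      (Matrix.of fun i' j' => chartCoordMap k M b I.1 (b (d.1 j')) i').det) = ⊤ := by
  rw [eq_top_iff]
  rintro p -
  induction p using MvPolynomial.induction_on with
  | C z =>
    rw [eq_intCast]
    exact intCast_mem _ z
  | add p q hp hq => exact Subring.add_mem _ hp hq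
  | mul_X p i hp =>
    obtain ⟨⟨j, hj⟩, i₀⟩ := i
    refine Subring.mul_mem _ hp (Subring.subset_closure ⟨⟨Function.update I.1 i₀ j, injective_update I.1 I.2 i₀ j hj⟩, ?_⟩)
    exact det_chartCoordMap_update M b I.1 I.2 i₀ j hj

end ChartRing

/-! ## §3 Chart transport: the maximal minors on `U_I` are the images of the ring-side minors -/

section Transport

/-- **The universal point over the chart image `ι_I(⊤)` is the push-forward of the universal chart point** along
`ℤ[X_I] ≅ Γ(Spec ℤ[X_I], ⊤) ≅ Γ(Gr, ι_I(⊤))` (★ `evalAffine_top_pointsEquiv_comp_symm_chartElem` at `𝟙`, moved along `ι_I` by ★ `evalAffine_map`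
and the inverse of `ι_I.appIso ⊤`). [cite: GortzWedhorn2020, (8.4) (pp. 213–215)] [cite: StacksProject, Tag 089T] -/
theorem evalAffine_image_top_eq_map (I : {I : Fin k → J // Function.Injective I}) :
    evalAffine ((isAffineOpen_top (chartScheme k I.1)).image_of_isOpenImmersion ((chartOpenCover k M b).f I))
        (pointsEquiv M k _ (𝟙 (grassmannianScheme M k))) =
      Module.Grassmannian.map
        ((((chartOpenCover k M b).f I).appIso ⊤).inv.hom.toIntAlgHom.comp
          (Scheme.ΓSpecIso (chartRing k I.1)).inv.hom.toIntAlgHom)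
        (chartElemAffine k M b I.1 I.2) := by
  have hW₁ : IsAffineOpen (((chartOpenCover k M b).f I) ''ᵁ ⊤) := (isAffineOpen_top (chartScheme k I.1)).image_of_isOpenImmersion ((chartOpenCover k M b).f I)
  have i₁ : (⊤ : (chartScheme k I.1).Opens) ≤ ((chartOpenCover k M b).f I) ⁻¹ᵁ (((chartOpenCover k M b).f I) ''ᵁ ⊤) := by rw [Scheme.Hom.preimage_image_eq]
  have ha := evalAffine_top_pointsEquiv_comp_symm_chartElem M b I (𝟙 (chartScheme k I.1))
  have h1 : ((𝟙 (chartScheme k I.1) : chartScheme k I.1 ⟶ chartScheme k I.1).appTop.hom.toIntAlgHom.comp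
      (Scheme.ΓSpecIso (chartRing k I.1)).inv.hom.toIntAlgHom) = (Scheme.ΓSpecIso (chartRing k I.1)).inv.hom.toIntAlgHom :=
    AlgHom.ext fun _ => rfl
  rw [h1, Category.id_comp, ← Category.comp_id ((chartOpenCover k M b).f I), pointsEquiv_comp] at ha
  have key := (evalAffine_map ((chartOpenCover k M b).f I) hW₁ (isAffineOpen_top (chartScheme k I.1)) i₁
    (pointsEquiv M k _ (𝟙 (grassmannianScheme M k)))).symm.trans ha
  have h4 := congrArg (Module.Grassmannian.map (((chartOpenCover k M b).f I).appIso ⊤).inv.hom.toIntAlgHom) key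
  rw [← Module.Grassmannian.map_comp, ← Module.Grassmannian.map_comp] at h4
  have hid : (((chartOpenCover k M b).f I).appIso ⊤).inv.hom.toIntAlgHom.comp (((chartOpenCover k M b).f I).appLE (((chartOpenCover k M b).f I) ''ᵁ ⊤) ⊤ i₁).hom.toIntAlgHom = AlgHom.id ℤ _ := by
    refine AlgHom.ext fun a => ?_
    change (((chartOpenCover k M b).f I).appLE (((chartOpenCover k M b).f I) ''ᵁ ⊤) ⊤ i₁ ≫ (((chartOpenCover k M b).f I).appIso ⊤).inv).hom a = a
    rw [← Scheme.Hom.appIso_hom', Iso.hom_inv_id]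
    rfl
  rw [hid] at h4
  have h3 := Module.Grassmannian.map_id (R := ℤ) (M := M) k
    (CommAlgCat.of ℤ Γ(grassmannianScheme M k, ((chartOpenCover k M b).f I) ''ᵁ ⊤))
    (evalAffine hW₁ (pointsEquiv M k _ (𝟙 (grassmannianScheme M k))))
  exact h3 ▸ h4

/-- **On the chart image `ι_I(⊤)` the maximal minor `det t_{I,d}` is the image of the ring-side minor** `det (I-coordinates of b ∘ d)` under
`ℤ[X_I] → Γ(Gr, ι_I(⊤))` (★ `coordMap_eq_of_map_chartElemAffine_eq`). [cite: EisenbudHarris2016, §3.2.2] [cite: StacksProject, Tag 089T] -/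
theorem det_transitionAt_image_top (I d : {I : Fin k → J // Function.Injective I}) :
    ((universalChartData k M b).transitionAt I d
        ((isAffineOpen_top (chartScheme k I.1)).image_of_isOpenImmersion ((chartOpenCover k M b).f I))
        (Scheme.Hom.image_top_eq_opensRange _).le).det =
      ((((chartOpenCover k M b).f I).appIso ⊤).inv.hom.comp (Scheme.ΓSpecIso (chartRing k I.1)).inv.hom)
        (Matrix.of fun i' j' => chartCoordMap k M b I.1 (b (d.1 j')) i').det := by
  have hN := (evalAffine_image_top_eq_map k M b I).symm
  unfold ChartData.transitionAt
  rw [RingHom.map_det, RingHom.mapMatrix_apply]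
  congr 1
  ext i' j'
  rw [Matrix.map_apply, Matrix.of_apply, Matrix.of_apply]
  exact coordMap_eq_of_map_chartElemAffine_eq M b I.1 I.2 _ _ hN _ (b (d.1 j')) i'

/-- The same on the chart open `U_I = ι_I.opensRange` of the universal chart data (restriction along `ι_I.opensRange = ι_I(⊤)`).
[cite: EisenbudHarris2016, §3.2.2] -/
theorem det_transitionAt_eq_secRes_image_top (I d : {I : Fin k → J // Function.Injective I}) :
    ((universalChartData k M b).transitionAt I d ((universalChartData k M b).isAffineOpen I) le_rfl).det =
      Modules.secRes (grassmannianScheme M k) (Scheme.Hom.image_top_eq_opensRange ((chartOpenCover k M b).f I)).ge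
        (((((chartOpenCover k M b).f I).appIso ⊤).inv.hom.comp (Scheme.ΓSpecIso (chartRing k I.1)).inv.hom)
          (Matrix.of fun i' j' => chartCoordMap k M b I.1 (b (d.1 j')) i').det) := by
  rw [← det_transitionAt_image_top]
  exact (secRes_det_transitionAt k M b I d _ ((universalChartData k M b).isAffineOpen I) _
    (Scheme.Hom.image_top_eq_opensRange ((chartOpenCover k M b).f I)).ge).symm

end Transport

/-! ## §4 The empty Grassmannian (`#J < k`) -/

section Empty

include b in
/-- **A point of `Gr(k, M)` forces `k ≤ #J`**: every point lies in a standard chart `U_I`, `I : Fin k ↪ J` (★ `exists_mem_universalChartData_U`).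
[cite: StacksProject, Tag 089T] -/
theorem le_card_of_point [Finite J] (t : grassmannianScheme M k) :
    k ≤ Nat.card J := by
  obtain ⟨I, -⟩ := exists_mem_universalChartData_U k M b t
  simpa only [Nat.card_eq_fintype_card, Fintype.card_fin] using Nat.card_le_card_of_injective I.1 I.2

include b in
/-- **`Gr(k, M)` is EMPTY when `#J < k`** (no rank-`k` quotient frames exist). [cite: StacksProject, Tag 089T] -/
theorem isEmpty_of_card_lt [Finite J] (hk : Nat.card J < k) : IsEmpty ↥(grassmannianScheme M k) :=
  ⟨fun t => absurd (le_card_of_point k M b t) (not_le.2 hk)⟩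

omit [(grassmannianSheaf M k).obj.IsRepresentable] in
/-- The Čech Picard group of an EMPTY scheme is trivial (any two point-indexed cocycles are vacuously cohomologous). [folklore] -/
private theorem subsingleton_cechPic_of_isEmpty {T : Scheme.{u}} [IsEmpty ↥T] : Subsingleton (CechPic T) := by
  refine ⟨fun a a' => ?_⟩
  obtain ⟨c, rfl⟩ := CechPic.mk_surjective a
  obtain ⟨c', rfl⟩ := CechPic.mk_surjective a'
  exact CechPic.sound (UnitCocycle.equiv_of_eq c c' (fun x => isEmptyElim x) (fun x => isEmptyElim x)
    (fun x => isEmptyElim x) (fun x => isEmptyElim x) fun x => isEmptyElim x)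

end Empty

/-! ## §5 The head: a closed immersion `θ : Gr ⟶ 𝐏ʳ_ℤ` with `[𝒪_{Gr}(-1)] = [det 𝒬]⁻¹` -/

section Head

/-- Restriction of `𝒪` between EQUAL opens is onto. [folklore] -/
private theorem secRes_surjective_of_eq {T : Scheme.{u}} {V V' : T.Opens} (h : V' = V) :
    Function.Surjective (Modules.secRes T h.le) := fun s =>
  ⟨Modules.secRes T h.ge s, by rw [Modules.secRes_secRes]; exact Modules.secRes_self _⟩

variable {n : ℕ} (e : Fin (n + 1) → {I : Fin k → J // Function.Injective I}) (he : Function.Surjective e)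

/-- **`Γ(Gr, U_{e i})` is generated by the Plücker ratios `p_{e j}/p_{e i}`** (the surjectivity hypothesis of [Hartshorne1977] II Prop. 7.2):
transport of ★ `closure_range_det_chartCoordMap` along `ℤ[X_I] ≅ Γ(Gr, U_I)` by §6 and `pluckerDatum_ratio`. [cite: Hartshorne1977, II Prop. 7.2]
[cite: EisenbudHarris2016, §3.2.2] -/
theorem closure_range_pluckerDatum_ratio (i : Fin (n + 1)) :
    Subring.closure (Set.range ((pluckerDatum k M b e he).ratio i)) = ⊤ := by
  set I := e i with hI
  set ιI := (chartOpenCover k M b).f I with hι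
  set ψ : chartRing k I.1 →+* Γ(grassmannianScheme M k, ιI ''ᵁ ⊤) :=
    (ιI.appIso ⊤).inv.hom.comp (Scheme.ΓSpecIso (chartRing k I.1)).inv.hom with hψ
  have h₂ : (universalChartData k M b).U I ≤ ιI ''ᵁ ⊤ := (Scheme.Hom.image_top_eq_opensRange ιI).ge
  set γ : chartRing k I.1 →+* Γ(grassmannianScheme M k, (pluckerDatum k M b e he).U i) :=
    (Modules.secRes _ (pluckerDatum_U k M b e he i).le).comp ((Modules.secRes _ h₂).comp ψ) with hγ
  have hψs : Function.Surjective ψ := by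
    intro s
    refine ⟨(Scheme.ΓSpecIso (chartRing k I.1)).hom ((ιI.appIso ⊤).hom s), ?_⟩
    change (ιI.appIso ⊤).inv ((Scheme.ΓSpecIso (chartRing k I.1)).inv
      ((Scheme.ΓSpecIso (chartRing k I.1)).hom ((ιI.appIso ⊤).hom s))) = s
    rw [Iso.hom_inv_id_apply, Iso.hom_inv_id_apply]
  have hγs : Function.Surjective γ := by
    intro s
    obtain ⟨s₁, rfl⟩ := secRes_surjective_of_eq (pluckerDatum_U k M b e he i) s
    obtain ⟨s₂, rfl⟩ := secRes_surjective_of_eq (Scheme.Hom.image_top_eq_opensRange ιI).symm s₁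
    obtain ⟨p, rfl⟩ := hψs s₂
    exact ⟨p, rfl⟩
  -- every ring-side minor maps to a Plücker ratio
  have hsub : γ '' Set.range (fun d : {I : Fin k → J // Function.Injective I} =>
      (Matrix.of fun i' j' => chartCoordMap k M b I.1 (b (d.1 j')) i').det) ⊆
      Set.range ((pluckerDatum k M b e he).ratio i) := by
    rintro _ ⟨_, ⟨d, rfl⟩, rfl⟩
    obtain ⟨j, hj⟩ := he d
    refine ⟨j, ?_⟩
    rw [pluckerDatum_ratio, det_transitionAt_eq_secRes_image_top, hj]
    rfl
  rw [eq_top_iff, ← RingHom.range_eq_top.2 hγs, RingHom.range_eq_map, ← closure_range_det_chartCoordMap M b I,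
    RingHom.map_closure]
  exact Subring.closure_mono hsub

/-- **THE HEAD (memo row P2a).  A closed immersion `θ : Gr(k, M) ⟶ 𝐏ʳ_ℤ` — the Plücker morphism of the maximal minors — with
`[𝒪_{Gr}(-1)] = [det 𝒬]⁻¹` in `Ȟ¹(Gr, 𝒪^×)`**: `detClass (serreTwist θ 1) = (detClass 𝒬)⁻¹` for the universal rank-`k` quotient `𝒬` ([GortzWedhorn2020]
Prop. 8.23: the Plücker embedding is a closed immersion; [Hartshorne1977] II Thm. 7.1: `θ^*𝒪(1)` is the line bundle defining `θ`, here `det 𝒬`).  No exterior powers;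
no hypothesis on `k` (for `#J < k` the Grassmannian is empty, §4, and `θ` is the initial morphism).
[cite: GortzWedhorn2020, (8.10) Prop. 8.23 (p. 220)] [cite: Hartshorne1977, II Thm. 7.1, Prop. 7.2 (pp. 150–151)] [cite: EisenbudHarris2016, §3.2.2] -/
theorem exists_isClosedImmersion_PP_detClass_serreTwist [Finite J] :
    ∃ (r : ℕ) (θ : grassmannianScheme M k ⟶ Morphisms.ProjCech.PP (ULift.{u} ℤ) r), IsClosedImmersion θ ∧
      detClass (SerreTwist.isFiniteLocallyFree_serreTwist θ 1) =
        (detClass (isFiniteLocallyFree_universalQuotient k M b))⁻¹ := by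
  classical
  by_cases hk : k ≤ Nat.card J
  swap
  · -- `#J < k`: the Grassmannian is EMPTY — `θ` is the initial morphism, the class identity is trivial
    haveI : IsEmpty ↥(grassmannianScheme M k) := isEmpty_of_card_lt k M b (not_le.1 hk)
    haveI := subsingleton_cechPic_of_isEmpty (T := grassmannianScheme M k)
    exact ⟨0, isInitialOfIsEmpty.to _, inferInstance, Subsingleton.elim _ _⟩
  -- the index type of injective frames is finite and non-empty
  haveI : Fintype {I : Fin k → J // Function.Injective I} := Fintype.ofFinite _
  haveI : Nonempty {I : Fin k → J // Function.Injective I} :=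
    ⟨⟨(Finite.equivFin J).symm ∘ Fin.castLE hk, (Finite.equivFin J).symm.injective.comp (Fin.castLE_injective hk)⟩⟩
  obtain ⟨n, hn⟩ : ∃ n, Fintype.card {I : Fin k → J // Function.Injective I} = n + 1 :=
    Nat.exists_eq_succ_of_ne_zero Fintype.card_ne_zero
  let e : Fin (n + 1) ≃ {I : Fin k → J // Function.Injective I} := (Fintype.equivFinOfCardEq hn).symm
  refine ⟨n, (pluckerDatum k M b e e.surjective).toProj (specULiftZIsTerminal.from _), ?_, ?_⟩
  · refine isClosedImmersion_toProj _ _ (isAffineOpen_pluckerDatum_U k M b e e.surjective) fun i => ?_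
    refine sectionsRingHom_surjective_of_closure_eq_top _ _ i (eq_top_iff.2 ?_)
    rw [← closure_range_pluckerDatum_ratio k M b e e.surjective i]
    exact Subring.closure_mono Set.subset_union_right
  · have h := detClass_serreTwist_toProj (specULiftZIsTerminal.from (grassmannianScheme M k))
      (detFrameSystem k M b).cocycle.lineBundleFrameSystem (detFrameSystem k M b).cocycle.lineBundleFrameSystem_rank
      (fun i => pluckerSection k M b (e i)) (iSup_basicOpen_coeff_pluckerCocycleSections_eq_top k M b e e.surjective) 1
    rw [pow_one, UnitCocycle.mk_lineBundleFrameSystem_cocycle, ← detClass_universalQuotient_eq_mk] at h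
    exact h

end Head

end Literature.AlgebraicGeometry.Motives.Grassmannian

end
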